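import Literature.AlgebraicGeometry.GroupSchemes.BirationalGroupLawGenericTranslate
import Literature.AlgebraicGeometry.GroupSchemes.SectionsThroughFibreDenseOpens
import HarnessLib

/-!
# A section generic for a point under the graph closure of a strict birational group law
# (Artin, *Néron models*, §2, proof of Lemma 2.3: «for `x ∈ V′` generic»)

Topic `Literature/AlgebraicGeometry/GroupSchemes`, namespace `Literature.AlgebraicGeometry.GroupSchemes`.
KERNEL ONLY: one theorem; no definition, no named fact, no instance, no `sorry`.  Cell `hodgecm-mathlib`, road W
(Néron capital), key lemma W1b (Artin's Lemma 2.3), step β3 «choice of the section».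

[Artin1986NeronModels] §2, proof of Lemma 2.3 (p. 222): given a point `(a, b, c)` of the closure of the graph of the
law, «let `x` be a section of `V` … such that `xa`, `xc` and `(xa)b` are defined» — possible because the Zariski-local
sections are dense in every fibre and each of the three conditions holds on an open dense in the fibre.  For SCHEME
points this is assembled from ★ `GroupSchemes.exists_open_forall_section_lift_mem` (one open `Ω ⊆ 𝒳` meeting the
fibre per condition), the irreducibility of the fibres of `𝒳 → S` (the three `Ω`'s meet the fibre simultaneously),
★ `GroupSchemes.exists_section_apply_mem` (a section through `Ω₁ ∩ Ω₂ ∩ Ω₃`), strictness (conditions `xa`, `xc`: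
`dom` is dense in the slices `V × {a}`, `V × {c}`) and ★ `BirationalGroupLaw.fibre_subset_closure_translateDom`
(condition `(xa)b`).

* `BirationalGroupLaw.exists_section_translates_defined` — for `L` strict on `𝒳 → S` universally open with
  geometrically irreducible fibres and fibrewise-dense sections, a point `p₀ = (a, b)` of `𝒳 ×_S 𝒳` and a point
  `c` of `𝒳` over the same point of `S`: there is a section `x` with `(x, a) ∈ dom`, `(x, c) ∈ dom` and
  `(x·a, b) ∈ dom` — the last phrased, as in `fibre_subset_closure_translateDom`, through ANY pair of morphisms
  `α = (v, a)`, `Θ = (v·a, b)` on `W = 𝒳 ×_S (𝒳 ×_S 𝒳)` characterised by their coordinates.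

## References
* [Artin1986NeronModels] M. Artin, *Néron models*, in *Arithmetic Geometry* (Cornell–Silverman eds.),
  Springer 1986, §2, Lemma 2.3 and its proof (p. 222); Thm. (1.12) (p. 217).
* [EdixhovenRomagny] B. Edixhoven, M. Romagny, *Group schemes out of birational group laws, Néron models*,
  Def. 3.4 (2).
-/

set_option autoImplicit false

noncomputable section

open CategoryTheory CategoryTheory.Limits AlgebraicGeometry TopologicalSpace Topology MonoidalCategory
  CartesianMonoidalCategory

namespace Literature.AlgebraicGeometry.GroupSchemes

universe u

variable {S : Scheme.{u}} {𝒳 : Over S}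

namespace BirationalGroupLaw

variable (L : BirationalGroupLaw 𝒳)

/-- **A section `x` with `xa`, `xc` and `(xa)b` defined** ([Artin1986NeronModels] §2, proof of Lemma 2.3, for scheme
points).  Let `L` be a STRICT birational group law on `𝒳 → S`, universally open with geometrically irreducible
fibres and with sections dense in every fibre (`hsec`).  Let `α = (v, a) : W → 𝒳 ×_S 𝒳` and `Θ = (v·a, b) : α⁻¹ dom
→ 𝒳 ×_S 𝒳` be the coordinate-characterised morphisms on `W = 𝒳 ×_S (𝒳 ×_S 𝒳)` of
`fibre_subset_closure_translateDom`.  Then for every point `p₀ = (a, b)` of `𝒳 ×_S 𝒳` and every point `c` of `𝒳`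
over the same point of `S` there is a section `x : S → 𝒳` such that `(x, a) ∈ dom`, `(x, c) ∈ dom` (points
`(x ∘ π, 𝟙)(a)`, `(x ∘ π, 𝟙)(c)` of `𝒳 ×_S 𝒳`) and the point `(x ∘ π, 𝟙)(p₀)` of `W` lies in `{w ∈ α⁻¹ dom : Θ w ∈ dom}`
(i.e. `(x·a, b) ∈ dom`). [cite: Artin1986NeronModels, §2, proof of Lemma 2.3 (p. 222) and Thm. (1.12) (p. 217)]
[cite: EdixhovenRomagny, Def. 3.4 (2)] -/
theorem exists_section_translates_defined [UniversallyOpen 𝒳.hom] [GeometricallyIrreducible 𝒳.hom]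
    (hL : L.IsStrict)
    (hsec : ∀ (x : 𝒳.left) (Ω : 𝒳.left.Opens), x ∈ Ω →
      ∃ a : S ⟶ 𝒳.left, a ≫ 𝒳.hom = 𝟙 S ∧ ∃ s : S, a.base s ∈ Ω ∧ 𝒳.hom.base (a.base s) = 𝒳.hom.base x)
    (α : pullback 𝒳.hom (𝒳 ⊗ 𝒳).hom ⟶ (𝒳 ⊗ 𝒳).left)
    (hα₁ : α ≫ (fst 𝒳 𝒳).left = pullback.fst 𝒳.hom (𝒳 ⊗ 𝒳).hom)
    (hα₂ : α ≫ (snd 𝒳 𝒳).left = pullback.snd 𝒳.hom (𝒳 ⊗ 𝒳).hom ≫ (fst 𝒳 𝒳).left)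
    (Θ : ((α ⁻¹ᵁ L.dom : (pullback 𝒳.hom (𝒳 ⊗ 𝒳).hom).Opens) : Scheme.{u}) ⟶ (𝒳 ⊗ 𝒳).left)
    (hΘ₁ : Θ ≫ (fst 𝒳 𝒳).left = (α ∣_ L.dom) ≫ L.mul)
    (hΘ₂ : Θ ≫ (snd 𝒳 𝒳).left = (α ⁻¹ᵁ L.dom).ι ≫ pullback.snd 𝒳.hom (𝒳 ⊗ 𝒳).hom ≫ (snd 𝒳 𝒳).left)
    (p₀ : ↑(𝒳 ⊗ 𝒳).left) (c : 𝒳.left) (hc : 𝒳.hom.base c = (𝒳 ⊗ 𝒳).hom.base p₀) :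
    ∃ (x : S ⟶ 𝒳.left) (hx : x ≫ 𝒳.hom = 𝟙 S),
      (pullback.lift (𝒳.hom ≫ x) (𝟙 𝒳.left) (by rw [Category.assoc, hx, Category.comp_id, Category.id_comp]) :
          𝒳.left ⟶ (𝒳 ⊗ 𝒳).left).base ((fst 𝒳 𝒳).left.base p₀) ∈ L.dom ∧
      (pullback.lift (𝒳.hom ≫ x) (𝟙 𝒳.left) (by rw [Category.assoc, hx, Category.comp_id, Category.id_comp]) :
          𝒳.left ⟶ (𝒳 ⊗ 𝒳).left).base c ∈ L.dom ∧
      (pullback.lift ((𝒳 ⊗ 𝒳).hom ≫ x) (𝟙 (𝒳 ⊗ 𝒳).left)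
          (by rw [Category.assoc, hx, Category.comp_id, Category.id_comp])).base p₀ ∈
        (α ⁻¹ᵁ L.dom).ι ''ᵁ (Θ ⁻¹ᵁ L.dom) := by
  have hdsnd : IsFibrewiseDense (snd 𝒳 𝒳).left (L.dom : Set ↑(𝒳 ⊗ 𝒳).left) := hL.1.2
  -- the base point `t` and the first coordinate `a₀`
  have hfstS : (fst 𝒳 𝒳).left ≫ 𝒳.hom = (𝒳 ⊗ 𝒳).hom := Over.w (fst 𝒳 𝒳)
  have ha₀ : 𝒳.hom.base ((fst 𝒳 𝒳).left.base p₀) = (𝒳 ⊗ 𝒳).hom.base p₀ := by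
    change ((fst 𝒳 𝒳).left ≫ 𝒳.hom).base p₀ = _; rw [hfstS]
  -- the fibre of `𝒳 → S` over `t` is irreducible
  have hirr : IsIrreducible (𝒳.hom.base ⁻¹' {(𝒳 ⊗ 𝒳).hom.base p₀}) :=
    𝒳.hom.isIrreducible_preimage 𝒳.hom.isOpenMap isIrreducible_singleton
  -- (i) `(x, a₀) ∈ dom` on an open `Ω₁` of values `x(t)`
  obtain ⟨Ω₁, hΩ₁ne, hΩ₁⟩ := exists_open_forall_section_lift_mem 𝒳.hom 𝒳.hom ((fst 𝒳 𝒳).left.base p₀)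
    (L.dom : (pullback 𝒳.hom 𝒳.hom).Opens) (hdsnd _) ⟨_, rfl⟩
  -- (ii) `(x, c) ∈ dom` on an open `Ω₂`
  obtain ⟨Ω₂, hΩ₂ne, hΩ₂⟩ := exists_open_forall_section_lift_mem 𝒳.hom 𝒳.hom c
    (L.dom : (pullback 𝒳.hom 𝒳.hom).Opens) (hdsnd _) ⟨_, rfl⟩
  -- (iii) `(x·a₀, b₀) ∈ dom` on an open `Ω₃`
  obtain ⟨Ω₃, hΩ₃ne, hΩ₃⟩ := exists_open_forall_section_lift_mem 𝒳.hom (𝒳 ⊗ 𝒳).hom p₀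
    ((α ⁻¹ᵁ L.dom).ι ''ᵁ (Θ ⁻¹ᵁ L.dom))
    (L.fibre_subset_closure_translateDom hL α hα₁ hα₂ Θ hΘ₁ hΘ₂ p₀) ⟨_, ha₀⟩
  -- the three opens meet the (irreducible) fibre over `t` simultaneously
  rw [ha₀] at hΩ₁ne
  rw [hc] at hΩ₂ne
  have h12 : ((𝒳.hom.base ⁻¹' {(𝒳 ⊗ 𝒳).hom.base p₀}) ∩ ((Ω₁ : Set 𝒳.left) ∩ Ω₂)).Nonempty :=
    hirr.isPreirreducible _ _ Ω₁.isOpen Ω₂.isOpen (by rwa [Set.inter_comm]) (by rwa [Set.inter_comm])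
  have h123 : ((𝒳.hom.base ⁻¹' {(𝒳 ⊗ 𝒳).hom.base p₀}) ∩
      (((Ω₁ : Set 𝒳.left) ∩ Ω₂) ∩ Ω₃)).Nonempty :=
    hirr.isPreirreducible _ _ (Ω₁.isOpen.inter Ω₂.isOpen) Ω₃.isOpen h12 (by rwa [Set.inter_comm])
  obtain ⟨x, hx, hxΩ⟩ := exists_section_apply_mem 𝒳.hom hsec ((𝒳 ⊗ 𝒳).hom.base p₀) (Ω₁ ⊓ Ω₂ ⊓ Ω₃)
    (by rw [Set.inter_comm] at h123; exact h123)
  have hx₁ : x.base ((𝒳 ⊗ 𝒳).hom.base p₀) ∈ Ω₁ := hxΩ.1.1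
  have hx₂ : x.base ((𝒳 ⊗ 𝒳).hom.base p₀) ∈ Ω₂ := hxΩ.1.2
  have hx₃ : x.base ((𝒳 ⊗ 𝒳).hom.base p₀) ∈ Ω₃ := hxΩ.2
  rw [← ha₀] at hx₁
  rw [← hc] at hx₂
  exact ⟨x, hx, hΩ₁ x hx hx₁, hΩ₂ x hx hx₂, hΩ₃ x hx hx₃⟩

end BirationalGroupLaw

end Literature.AlgebraicGeometry.GroupSchemes

end
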